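import Summits.NavierStokesRegularity.NavierStokesRegularity.Theorems.SqueezeCycleRecurrentLiouvilleClassLimit
import Summits.NavierStokesRegularity.NavierStokesRegularity.Theorems.SqueezeCycleRecurrentLiouvilleSelfSimilarRepr
import Summits.NavierStokesRegularity.NavierStokesRegularity.Theorems.SqueezeCycleRecurrentLiouvilleSelfSimilarMildVanishes
import Summits.NavierStokesRegularity.NavierStokesRegularity.Theorems.SqueezeCycleRecurrentLiouvilleOrbitContinuous
import Literature.Analysis.FluidPDE.SpaceTimeRescaling
import HarnessLib

/-!
# Crux `RecurrentLiouville` (stmt-NavierStokesRegularity-1589), line `Sketch` — Branch A′: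
  no near-identity discretely self-similar Type-I singularity models in the Albritton–Barker class

`stub_rlNearIdentityDSS`: for every rate constant `C` and bound `M < ⊤` there is `Λ(C, M) > 1` such
that a suitable weak solution of Navier–Stokes (`ν = 1`, `f = 0`) on `ℝ³ × ℝ₋` with a weak gradient,
`𝐈(ℝ³ × ℝ₋) ≤ M`, the Type-I rate `‖u(t,x)‖ ≤ C/√(−t)`, and `λ`-discretely self-similar ALMOST
EVERYWHERE for some `λ ∈ (1, Λ)`, is regular at the space–time origin — the `λ → 1⁺` rung of the crux
(`λ`-DSS profiles are uniformly recurrent) in the crux's own class (time rate only, suitable weak,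
a.e. self-similarity); compare Chae–Wolf 2017 Thm 1.3 / Pineau–Vicol 2026 Thm 1.6 (smooth profiles,
space–time bound `C/(|x| + √(−t))`, threshold depending on `C` only).  Proof: contradiction +
compactness (`stub_rlClassLimit`); the limit is a.e. scale invariant because the integer powers
`λ_k^{⌊σ/log λ_k⌋} → e^σ` fix `u_k` a.e. and the scaling orbit of the limit is continuous in `L³`
(`stub_rlOrbitContinuous`); then `stub_rlSelfSimilarRepr` + `stub_rlSelfSimilarMildVanishes` (Tsai
1998 Thm 1, `q = ∞`, KNSS gauge) make it zero — contradicting its singular origin.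
References: [ChaeWolf2017RemovingDSS] arXiv:1610.09464 Thm 1.3; [Tsai1998] Thm 1;
[AlbrittonBarker2019] arXiv:1811.00502 Lemma 2.2, Prop. 2.3.
-/

noncomputable section

-- the sub-problem namespace repeats the summit name (D-0017 layout `Summit.<S>.<P>.Theorems`)
set_option linter.dupNamespace false

namespace Summit.NavierStokesRegularity.NavierStokesRegularity.Theorems

open MeasureTheory Set Function Filter Topology TopologicalSpace Metric Literature.Analysis.FluidPDE
open scoped NNReal ENNReal

/-- Local notation for physical space. -/
local notation "E3" => EuclideanSpace ℝ (Fin 3)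

/-- **Transport of an a.e. identity along a parabolic dilation.**  If `F z = G z` for a.e. `z` in the
open backward slab, then `F (c²t, cx) = G (c²t, cx)` for a.e. `(t, x)` in the slab (`c > 0`): the
dilation is non-singular and preserves the slab. [folklore] -/
theorem rlNearIdentityDSS_ae_comp_dilation {F G : ℝ × E3 → E3} {c : ℝ} (hc : 0 < c)
    (h : ∀ᵐ z ∂(volume.restrict (Iio (0 : ℝ) ×ˢ (univ : Set E3))), F z = G z) :
    ∀ᵐ z ∂(volume.restrict (Iio (0 : ℝ) ×ˢ (univ : Set E3))),
      F (c ^ 2 * z.1, c • z.2) = G (c ^ 2 * z.1, c • z.2) := by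
  have hc2 : 0 < c ^ 2 := by positivity
  have hΦ := ae_restrict_preimage_stAffine hc2 hc 0 (0 : E3) h
  rw [stAffine_sq_preimage_Iio_prod_univ hc.ne'] at hΦ
  filter_upwards [hΦ] with z hz
  have e : stAffine (c ^ 2) c 0 (0 : E3) z = (c ^ 2 * z.1, c • z.2) := by
    rw [show z = (z.1, z.2) from rfl, stAffine_apply, zero_add, zero_add]
  rwa [e] at hz

/-- **Iterating an a.e. discrete self-similarity.**  If `u_λ = u` a.e. on the slab (`λ > 0`), then
`u_{λⁿ} = u` a.e. on the slab for every `n : ℕ`. [folklore] -/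
theorem rlNearIdentityDSS_ae_pow {u : ℝ → E3 → E3} {lam : ℝ} (hlam : 0 < lam)
    (h : ∀ᵐ z ∂(volume.restrict (Iio (0 : ℝ) ×ˢ (univ : Set E3))), nsRescale lam u z.1 z.2 = u z.1 z.2)
    (n : ℕ) :
    ∀ᵐ z ∂(volume.restrict (Iio (0 : ℝ) ×ˢ (univ : Set E3))),
      nsRescale (lam ^ n) u z.1 z.2 = u z.1 z.2 := by
  induction n with
  | zero =>
      exact Eventually.of_forall fun z => by rw [pow_zero, nsRescale_one]
  | succ n ih =>
      -- transport the identity `u_λ = u` along the dilation by `λⁿ`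
      have hcn : 0 < lam ^ n := pow_pos hlam n
      have ht := rlNearIdentityDSS_ae_comp_dilation (F := fun z => nsRescale lam u z.1 z.2)
        (G := fun z => u z.1 z.2) hcn h
      filter_upwards [ht, ih] with z hz hz'
      rw [pow_succ', nsRescale_mul, nsRescale_apply, hz, ← nsRescale_apply, hz']

/-- **Inverting an a.e. self-similarity.**  If `u_c = u` a.e. on the slab (`c > 0`), then
`u_{c⁻¹} = u` a.e. on the slab. [folklore] -/
theorem rlNearIdentityDSS_ae_inv {u : ℝ → E3 → E3} {c : ℝ} (hc : 0 < c)
    (h : ∀ᵐ z ∂(volume.restrict (Iio (0 : ℝ) ×ˢ (univ : Set E3))), nsRescale c u z.1 z.2 = u z.1 z.2) :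
    ∀ᵐ z ∂(volume.restrict (Iio (0 : ℝ) ×ˢ (univ : Set E3))),
      nsRescale c⁻¹ u z.1 z.2 = u z.1 z.2 := by
  have hci : 0 < c⁻¹ := inv_pos.2 hc
  have ht := rlNearIdentityDSS_ae_comp_dilation (F := fun z => nsRescale c u z.1 z.2)
    (G := fun z => u z.1 z.2) hci h
  filter_upwards [ht] with z hz
  simp only [nsRescale_apply, smul_smul] at hz ⊢
  have e1 : c ^ 2 * (c⁻¹ ^ 2 * z.1) = z.1 := by field_simp
  have e2 : c * c⁻¹ = 1 := mul_inv_cancel₀ hc.ne'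
  rw [e1, e2, one_smul] at hz
  -- `hz : c • u z.1 z.2 = u (c⁻¹² t, c⁻¹ x)`
  rw [← hz, smul_smul, inv_mul_cancel₀ hc.ne', one_smul]

/-- For `λ_k → 1⁺` and `σ > 0`, the scales `c_k = exp(⌊σ / log λ_k⌋ · log λ_k)` (integer powers of
`λ_k`) tend to `e^σ`, and `1 ≤ c_k ≤ e^σ`. [folklore] -/
theorem rlNearIdentityDSS_scales {lam : ℕ → ℝ} (hlam : ∀ k, 1 < lam k)
    (hlim : Tendsto lam atTop (𝓝 1)) {σ : ℝ} (hσ : 0 < σ) :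
    Tendsto (fun k => Real.exp ((⌊σ / Real.log (lam k)⌋₊ : ℝ) * Real.log (lam k))) atTop
        (𝓝 (Real.exp σ)) ∧
      (∀ k, 1 ≤ Real.exp ((⌊σ / Real.log (lam k)⌋₊ : ℝ) * Real.log (lam k))) ∧
      ∀ k, Real.exp ((⌊σ / Real.log (lam k)⌋₊ : ℝ) * Real.log (lam k)) ≤ Real.exp σ := by
  have hlog : ∀ k, 0 < Real.log (lam k) := fun k => Real.log_pos (hlam k)
  have hup : ∀ k, (⌊σ / Real.log (lam k)⌋₊ : ℝ) * Real.log (lam k) ≤ σ := fun k => by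
    have h1 : (⌊σ / Real.log (lam k)⌋₊ : ℝ) ≤ σ / Real.log (lam k) :=
      Nat.floor_le (div_nonneg hσ.le (hlog k).le)
    calc (⌊σ / Real.log (lam k)⌋₊ : ℝ) * Real.log (lam k)
        ≤ σ / Real.log (lam k) * Real.log (lam k) := mul_le_mul_of_nonneg_right h1 (hlog k).le
      _ = σ := div_mul_cancel₀ σ (hlog k).ne'
  have hlow : ∀ k, σ - Real.log (lam k) ≤ (⌊σ / Real.log (lam k)⌋₊ : ℝ) * Real.log (lam k) := by
    intro k
    have h1 : σ / Real.log (lam k) < (⌊σ / Real.log (lam k)⌋₊ : ℝ) + 1 := Nat.lt_floor_add_one _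
    have h2 : σ < ((⌊σ / Real.log (lam k)⌋₊ : ℝ) + 1) * Real.log (lam k) := by
      have := mul_lt_mul_of_pos_right h1 (hlog k)
      rwa [div_mul_cancel₀ σ (hlog k).ne'] at this
    linarith [h2]
  refine ⟨?_, fun k => ?_, fun k => Real.exp_le_exp.2 (hup k)⟩
  · -- `log λ_k → 0`, so the exponent is squeezed to `σ`
    have hlog0 : Tendsto (fun k => Real.log (lam k)) atTop (𝓝 0) := by
      have h := (Real.continuousAt_log one_ne_zero).tendsto.comp hlim
      rwa [Function.comp_def, Real.log_one] at h
    have hexp : Tendsto (fun k => (⌊σ / Real.log (lam k)⌋₊ : ℝ) * Real.log (lam k)) atTop (𝓝 σ) := by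
      refine tendsto_of_tendsto_of_tendsto_of_le_of_le ?_ tendsto_const_nhds hlow hup
      have h : Tendsto (fun k => σ - Real.log (lam k)) atTop (𝓝 (σ - 0)) :=
        tendsto_const_nhds.sub hlog0
      rwa [sub_zero] at h
    exact (Real.continuous_exp.tendsto σ).comp hexp
  · have h0 : 0 ≤ (⌊σ / Real.log (lam k)⌋₊ : ℝ) * Real.log (lam k) :=
      mul_nonneg (Nat.cast_nonneg _) (hlog k).le
    simpa using Real.exp_le_exp.2 h0

/-- The exact scaling constant `c (c⁵)^{-1/3}` is at most `c` for `c ≥ 1`. [folklore] -/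
theorem rlNearIdentityDSS_zoomConst_le {c : ℝ} (hc : 1 ≤ c) :
    ‖c‖ₑ * (ENNReal.ofReal (c ^ 2 * c ^ 3)⁻¹) ^ (1 / (3 : ℝ≥0∞).toReal) ≤ ENNReal.ofReal c := by
  have h1 : (ENNReal.ofReal (c ^ 2 * c ^ 3)⁻¹) ^ (1 / (3 : ℝ≥0∞).toReal) ≤ 1 :=
    ENNReal.rpow_le_one (ENNReal.ofReal_le_one.2 (inv_le_one_of_one_le₀
      (one_le_mul_of_one_le_of_one_le (one_le_pow₀ hc) (one_le_pow₀ hc)))) (by norm_num)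
  calc ‖c‖ₑ * (ENNReal.ofReal (c ^ 2 * c ^ 3)⁻¹) ^ (1 / (3 : ℝ≥0∞).toReal)
      ≤ ‖c‖ₑ * 1 := mul_le_mul' le_rfl h1
    _ = ENNReal.ofReal c := by
        rw [mul_one, Real.enorm_eq_ofReal (zero_le_one.trans hc)]

/-- If `x ≤ A_k + B_k + D_k` for all `k` with `A_k, B_k, D_k → 0` in `ℝ≥0∞`, then `x = 0`. [folklore] -/
theorem rlNearIdentityDSS_eq_zero_of_le_three {x : ℝ≥0∞} {A B D : ℕ → ℝ≥0∞}
    (hle : ∀ k, x ≤ A k + B k + D k) (hA : Tendsto A atTop (𝓝 0)) (hB : Tendsto B atTop (𝓝 0))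
    (hD : Tendsto D atTop (𝓝 0)) : x = 0 := by
  have hlim := (hA.add hB).add hD
  rw [add_zero, add_zero] at hlim
  exact le_antisymm (ge_of_tendsto' hlim hle) zero_le

/-- **Main estimate (`σ > 0`, one ball).**  If `λ_k → 1⁺`, `u_k → w` in every `L³(Q(0, R))`,
`(u_k)_{λ_k} = u_k` a.e. on the slab and the scaling orbit of `w` is continuous in `L³` on the balls,
then `‖w_{e^σ} − w‖_{L³(Q(0,R))} = 0` (through the integer powers `c_k = λ_k^{⌊σ/log λ_k⌋} → e^σ`,
which fix `u_k` a.e.; exact scaling law; `1 ≤ c_k ≤ e^σ`). [folklore] -/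
theorem rlNearIdentityDSS_ball
    {lam : ℕ → ℝ} (hlam : ∀ k, 1 < lam k) (hlim : Tendsto lam atTop (𝓝 1))
    {u : ℕ → ℝ → EuclideanSpace ℝ (Fin 3) → EuclideanSpace ℝ (Fin 3)}
    {w : ℝ → EuclideanSpace ℝ (Fin 3) → EuclideanSpace ℝ (Fin 3)}
    (hum : ∀ (k : ℕ) (c : ℝ), 0 < c → ∀ R : ℝ, 0 < R → AEStronglyMeasurable (uncurry (nsRescale c (u k)))
      (volume.restrict (parabolicCylinder R (0 : ℝ × EuclideanSpace ℝ (Fin 3)))))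
    (hwm : ∀ (c : ℝ), 0 < c → ∀ R : ℝ, 0 < R → AEStronglyMeasurable (uncurry (nsRescale c w))
      (volume.restrict (parabolicCylinder R (0 : ℝ × EuclideanSpace ℝ (Fin 3)))))
    (hconv : ∀ R : ℝ, 0 < R → Tendsto (fun k => eLpNorm (uncurry (u k) - uncurry w) 3
      (volume.restrict (parabolicCylinder R (0 : ℝ × EuclideanSpace ℝ (Fin 3))))) atTop (𝓝 0))
    (hdss : ∀ k, ∀ᵐ z ∂(volume.restrict (Iio (0 : ℝ) ×ˢ (univ : Set (EuclideanSpace ℝ (Fin 3))))),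
      nsRescale (lam k) (u k) z.1 z.2 = u k z.1 z.2)
    (horbit : ∀ R : ℝ, 0 < R → Tendsto (fun c : ℝ => eLpNorm (uncurry (nsRescale c w) - uncurry w) 3
      (volume.restrict (parabolicCylinder R (0 : ℝ × EuclideanSpace ℝ (Fin 3))))) (𝓝 1) (𝓝 0))
    {σ : ℝ} (hσ : 0 < σ) {R : ℝ} (hR : 0 < R) :
    eLpNorm (uncurry (nsRescale (Real.exp σ) w) - uncurry w) 3
      (volume.restrict (parabolicCylinder R (0 : ℝ × EuclideanSpace ℝ (Fin 3)))) = 0 := by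
  -- the approximating integer powers `c_k = λ_k^{n_k} → e^σ`
  set c : ℕ → ℝ := fun k => Real.exp ((⌊σ / Real.log (lam k)⌋₊ : ℝ) * Real.log (lam k)) with hc
  obtain ⟨hclim, hc1, hcle⟩ := rlNearIdentityDSS_scales hlam hlim hσ
  have hc0 : ∀ k, 0 < c k := fun k => Real.exp_pos _
  have he : 0 < Real.exp σ := Real.exp_pos σ
  -- `(u_k)_{c_k} = u_k` a.e. on the slab
  have hfix : ∀ k, ∀ᵐ z ∂(volume.restrict (Iio (0 : ℝ) ×ˢ (univ : Set (EuclideanSpace ℝ (Fin 3))))),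
      nsRescale (c k) (u k) z.1 z.2 = u k z.1 z.2 := by
    intro k
    have h := rlNearIdentityDSS_ae_pow (zero_lt_one.trans (hlam k)) (hdss k) ⌊σ / Real.log (lam k)⌋₊
    have e : c k = lam k ^ ⌊σ / Real.log (lam k)⌋₊ := by
      rw [hc]; dsimp only; rw [Real.exp_nat_mul, Real.exp_log (zero_lt_one.trans (hlam k))]
    rw [e]
    exact h
  -- notation for the measure and the players
  set μR : Measure (ℝ × EuclideanSpace ℝ (Fin 3)) :=
    volume.restrict (parabolicCylinder R (0 : ℝ × EuclideanSpace ℝ (Fin 3))) with hμR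
  set F : ℝ × EuclideanSpace ℝ (Fin 3) → EuclideanSpace ℝ (Fin 3) :=
    uncurry (nsRescale (Real.exp σ) w) with hF
  set G : ℕ → ℝ × EuclideanSpace ℝ (Fin 3) → EuclideanSpace ℝ (Fin 3) :=
    fun k => uncurry (nsRescale (c k) w) with hG
  set Hk : ℕ → ℝ × EuclideanSpace ℝ (Fin 3) → EuclideanSpace ℝ (Fin 3) :=
    fun k => uncurry (nsRescale (c k) (u k)) with hHk
  have hwm1 : ∀ r : ℝ, 0 < r → AEStronglyMeasurable (uncurry w)
      (volume.restrict (parabolicCylinder r (0 : ℝ × EuclideanSpace ℝ (Fin 3)))) := by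
    intro r hr
    have h := hwm 1 one_pos r hr
    rwa [nsRescale_one] at h
  have hum1 : ∀ (k : ℕ) (r : ℝ), 0 < r → AEStronglyMeasurable (uncurry (u k))
      (volume.restrict (parabolicCylinder r (0 : ℝ × EuclideanSpace ℝ (Fin 3)))) := by
    intro k r hr
    have h := hum k 1 one_pos r hr
    rwa [nsRescale_one] at h
  have hFm : AEStronglyMeasurable F μR := hwm _ he R hR
  have hWm : AEStronglyMeasurable (uncurry w) μR := hwm1 R hR
  have hGm : ∀ k, AEStronglyMeasurable (G k) μR := fun k => hwm _ (hc0 k) R hR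
  have hHm : ∀ k, AEStronglyMeasurable (Hk k) μR := fun k => hum k _ (hc0 k) R hR
  -- `H_k = u_k` a.e. on the ball
  have hHae : ∀ k, Hk k =ᵐ[μR] uncurry (u k) := fun k =>
    ae_restrict_of_ae_restrict_of_subset (parabolicCylinder_origin_subset_slab R) (hfix k)
  -- the three-term bound
  have h13 : (1 : ℝ≥0∞) ≤ 3 := by norm_num
  have hle : ∀ k, eLpNorm (F - uncurry w) 3 μR ≤
      eLpNorm (F - G k) 3 μR +
        ENNReal.ofReal (Real.exp σ) * eLpNorm (uncurry (u k) - uncurry w) 3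
          (volume.restrict (parabolicCylinder (Real.exp σ * R) (0 : ℝ × EuclideanSpace ℝ (Fin 3)))) +
        eLpNorm (uncurry (u k) - uncurry w) 3 μR := by
    intro k
    have e : F - uncurry w = (F - G k) + ((G k - Hk k) + (Hk k - uncurry w)) := by
      rw [sub_add_sub_cancel, sub_add_sub_cancel]
    have hB : eLpNorm (G k - Hk k) 3 μR ≤
        ENNReal.ofReal (Real.exp σ) * eLpNorm (uncurry (u k) - uncurry w) 3
          (volume.restrict (parabolicCylinder (Real.exp σ * R) (0 : ℝ × EuclideanSpace ℝ (Fin 3)))) := by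
      have hz : eLpNorm (G k - Hk k) 3 μR =
          ‖c k‖ₑ * (ENNReal.ofReal (c k ^ 2 * c k ^ 3)⁻¹) ^ (1 / (3 : ℝ≥0∞).toReal) *
            eLpNorm (uncurry w - uncurry (u k)) 3
              (volume.restrict (parabolicCylinder (c k * R) (0 : ℝ × EuclideanSpace ℝ (Fin 3)))) := by
        rw [hG, hHk, hμR]
        dsimp only
        rw [nsRescale_eq_zoom, nsRescale_eq_zoom, eLpNorm_zoom_sub_zoom _ _ (hc0 k) R]
      rw [hz, eLpNorm_sub_comm]
      have hK : ‖c k‖ₑ * (ENNReal.ofReal (c k ^ 2 * c k ^ 3)⁻¹) ^ (1 / (3 : ℝ≥0∞).toReal) ≤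
          ENNReal.ofReal (Real.exp σ) :=
        (rlNearIdentityDSS_zoomConst_le (hc1 k)).trans (ENNReal.ofReal_le_ofReal (hcle k))
      have hmono : eLpNorm (uncurry (u k) - uncurry w) 3
          (volume.restrict (parabolicCylinder (c k * R) (0 : ℝ × EuclideanSpace ℝ (Fin 3)))) ≤
          eLpNorm (uncurry (u k) - uncurry w) 3
            (volume.restrict (parabolicCylinder (Real.exp σ * R) (0 : ℝ × EuclideanSpace ℝ (Fin 3)))) :=
        eLpNorm_mono_measure _ (Measure.restrict_mono
          (SuitableCompactness.parabolicCylinder_zero_mono (by positivity)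
            (mul_le_mul_of_nonneg_right (hcle k) hR.le)) le_rfl)
      exact mul_le_mul' hK hmono
    have hD : eLpNorm (Hk k - uncurry w) 3 μR = eLpNorm (uncurry (u k) - uncurry w) 3 μR :=
      eLpNorm_congr_ae ((hHae k).sub (ae_eq_refl _))
    calc eLpNorm (F - uncurry w) 3 μR
        ≤ eLpNorm (F - G k) 3 μR + eLpNorm ((G k - Hk k) + (Hk k - uncurry w)) 3 μR := by
          rw [e]; exact eLpNorm_add_le (hFm.sub (hGm k)) (((hGm k).sub (hHm k)).add ((hHm k).sub hWm)) h13
      _ ≤ eLpNorm (F - G k) 3 μR + (eLpNorm (G k - Hk k) 3 μR + eLpNorm (Hk k - uncurry w) 3 μR) :=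
          add_le_add le_rfl (eLpNorm_add_le ((hGm k).sub (hHm k)) ((hHm k).sub hWm) h13)
      _ ≤ _ := by
          rw [hD, ← add_assoc]
          exact add_le_add (add_le_add le_rfl hB) le_rfl
  -- the three terms tend to zero
  have hA : Tendsto (fun k => eLpNorm (F - G k) 3 μR) atTop (𝓝 0) := by
    -- `G k = (w_{r_k})_{e^σ}` with `r_k = c_k e^{-σ} → 1`
    set r : ℕ → ℝ := fun k => c k * Real.exp (-σ) with hr
    have hr0 : ∀ k, 0 < r k := fun k => mul_pos (hc0 k) (Real.exp_pos _)
    have hr1 : Tendsto r atTop (𝓝 1) := by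
      have h := hclim.mul_const (Real.exp (-σ))
      rwa [← Real.exp_add, add_neg_cancel, Real.exp_zero] at h
    have e : ∀ k, eLpNorm (F - G k) 3 μR =
        ‖Real.exp σ‖ₑ * (ENNReal.ofReal (Real.exp σ ^ 2 * Real.exp σ ^ 3)⁻¹) ^ (1 / (3 : ℝ≥0∞).toReal) *
          eLpNorm (uncurry (nsRescale (r k) w) - uncurry w) 3
            (volume.restrict (parabolicCylinder (Real.exp σ * R) (0 : ℝ × EuclideanSpace ℝ (Fin 3)))) := by
      intro k
      have eck : c k = r k * Real.exp σ := by
        rw [hr]; dsimp only; rw [mul_assoc, ← Real.exp_add, neg_add_cancel, Real.exp_zero, mul_one]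
      rw [hF, hG, hμR]
      dsimp only
      rw [eck, nsRescale_mul, nsRescale_eq_zoom (Real.exp σ) w,
        nsRescale_eq_zoom (Real.exp σ) (nsRescale (r k) w), eLpNorm_zoom_sub_zoom _ _ he R,
        eLpNorm_sub_comm]
    simp_rw [e]
    have hRσ : 0 < Real.exp σ * R := by positivity
    have h := ENNReal.Tendsto.const_mul ((horbit (Real.exp σ * R) hRσ).comp hr1)
      (Or.inr (zoomConst_ne_top (Real.exp σ)))
      (a := ‖Real.exp σ‖ₑ * (ENNReal.ofReal (Real.exp σ ^ 2 * Real.exp σ ^ 3)⁻¹) ^ (1 / (3 : ℝ≥0∞).toReal))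
    rw [mul_zero] at h
    simpa only [Function.comp_def] using h
  have hB : Tendsto (fun k => ENNReal.ofReal (Real.exp σ) * eLpNorm (uncurry (u k) - uncurry w) 3
      (volume.restrict (parabolicCylinder (Real.exp σ * R) (0 : ℝ × EuclideanSpace ℝ (Fin 3)))))
      atTop (𝓝 0) := by
    have hRσ : 0 < Real.exp σ * R := by positivity
    have h := ENNReal.Tendsto.const_mul (hconv (Real.exp σ * R) hRσ) (Or.inr ENNReal.ofReal_ne_top)
      (a := ENNReal.ofReal (Real.exp σ))
    rwa [mul_zero] at h
  have hD : Tendsto (fun k => eLpNorm (uncurry (u k) - uncurry w) 3 μR) atTop (𝓝 0) := hconv R hR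
  exact rlNearIdentityDSS_eq_zero_of_le_three hle hA hB hD


/-- **Branch A′ — no near-identity discretely self-similar Type-I singularity models in the
Albritton–Barker class.**  For every rate constant `C` and bound `M < ⊤` there is `Λ = Λ(C, M) > 1`
such that every suitable weak solution `(u, p)` of Navier–Stokes (`ν = 1`, `f = 0`) on `ℝ³ × ℝ₋`
with weak gradient `G`, `𝐈(ℝ³ × ℝ₋) ≤ M`, the Type-I rate `‖u(t,x)‖ ≤ C/√(−t)`, and which is
`λ`-discretely self-similar almost everywhere (`λ u(λ²t, λx) = u(t,x)` a.e. on the slab) for some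
`λ ∈ (1, Λ)`, is regular at the space–time origin.  Since `λ`-DSS profiles are uniformly recurrent
under the scaling flow, this is a genuine sub-case of the crux `RecurrentLiouville`; it is the
analogue in the crux's class (time rate only, no spatial decay, suitable weak) of Chae–Wolf 2017,
Thm 1.3 / Pineau–Vicol 2026, Thm 1.6.  Proof: contradiction (`Λ_k = 1 + 1/(k+1)`), class limit
(`stub_rlClassLimit`), a.e. scale invariance of the limit (`rlNearIdentityDSS_ball` for `σ > 0`,
inversion for `σ < 0`), the continuous Type-I ancient mild representative
(`stub_rlSelfSimilarRepr`) and the self-similar rung (`stub_rlSelfSimilarMildVanishes`).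
[cite: ChaeWolf2017RemovingDSS, Thm 1.3; Tsai1998, Thm 1; AlbrittonBarker2019, Lemma 2.2, Prop. 2.3] -/
theorem stub_rlNearIdentityDSS :
    ∀ (C : ℝ) (M : ℝ≥0∞), M < ⊤ → ∃ Λ : ℝ, 1 < Λ ∧
      ∀ (lam : ℝ), 1 < lam → lam < Λ →
        ∀ (u : ℝ → EuclideanSpace ℝ (Fin 3) → EuclideanSpace ℝ (Fin 3))
          (p : ℝ → EuclideanSpace ℝ (Fin 3) → ℝ)
          (G : ℝ → EuclideanSpace ℝ (Fin 3) → EuclideanSpace ℝ (Fin 3) →L[ℝ] EuclideanSpace ℝ (Fin 3)),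
          IsSuitableWeakSolutionOn (slab (EuclideanSpace ℝ (Fin 3)) (Iio 0) isOpen_Iio) 1 0 u p →
          HasWeakSpatialGradientOn (slab (EuclideanSpace ℝ (Fin 3)) (Iio 0) isOpen_Iio) u G →
          typeIBound (Iio (0 : ℝ) ×ˢ univ) u p G ≤ M →
          HasTypeITimeDecay C u →
          (∀ᵐ z ∂(volume.restrict (Iio (0 : ℝ) ×ˢ (univ : Set (EuclideanSpace ℝ (Fin 3))))),
            nsRescale lam u z.1 z.2 = u z.1 z.2) →
          ¬ IsBackwardSingularPoint u 0 := by
  intro C M hM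
  by_contra hcon
  push Not at hcon
  have hΛ : ∀ k : ℕ, (1 : ℝ) < 1 + 1 / ((k : ℝ) + 1) := fun k => by
    have : (0 : ℝ) < 1 / ((k : ℝ) + 1) := by positivity
    linarith
  choose lam hlam1 hlamΛ u p G hsw hwg hI hdec hdss hsing using fun k : ℕ => hcon _ (hΛ k)
  -- `λ_k → 1`
  have hlim : Tendsto lam atTop (𝓝 1) := by
    have h1 : Tendsto (fun k : ℕ => (1 : ℝ) + 1 / ((k : ℝ) + 1)) atTop (𝓝 1) := by
      have h := (tendsto_one_div_add_atTop_nhds_zero_nat (𝕜 := ℝ)).const_add 1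
      rwa [add_zero] at h
    exact tendsto_of_tendsto_of_tendsto_of_le_of_le tendsto_const_nhds h1
      (fun k => (hlam1 k).le) (fun k => (hlamΛ k).le)
  -- S1: a singular class limit with the rate
  obtain ⟨w, q, H, ψ, hψ, hsw', hwg', hI', hdec', hsing', hconv⟩ :=
    stub_rlClassLimit C M hM u p G hsw hwg hI hdec hsing
  -- measurability of (rescaled) class profiles on the balls
  have hmeas : ∀ (k : ℕ) (c : ℝ), 0 < c → ∀ R : ℝ, 0 < R →
      AEStronglyMeasurable (uncurry (nsRescale c (u k)))
        (volume.restrict (parabolicCylinder R (0 : ℝ × EuclideanSpace ℝ (Fin 3)))) := by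
    intro k c hc R _
    rw [nsRescale_eq_zoom]
    exact (zoom_slabProfile (hsw k) (hwg k) hc).2.1.locallyIntegrableOn.aestronglyMeasurable.mono_measure
      (Measure.restrict_mono (parabolicCylinder_origin_subset_slab _) le_rfl)
  have hmeasw : ∀ (c : ℝ), 0 < c → ∀ R : ℝ, 0 < R →
      AEStronglyMeasurable (uncurry (nsRescale c w))
        (volume.restrict (parabolicCylinder R (0 : ℝ × EuclideanSpace ℝ (Fin 3)))) := by
    intro c hc R _
    rw [nsRescale_eq_zoom]
    exact (zoom_slabProfile hsw' hwg' hc).2.1.locallyIntegrableOn.aestronglyMeasurable.mono_measure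
      (Measure.restrict_mono (parabolicCylinder_origin_subset_slab _) le_rfl)
  -- S6: the orbit of `w` is continuous in `L³` on the balls
  have horbit := stub_rlOrbitContinuous w (fun R hR => memLp_three_of_slabProfile hwg' hI' hR)
  -- a.e. scale invariance of `w` on the slab, first for `σ > 0` on every ball
  have hpos : ∀ σ : ℝ, 0 < σ → ∀ᵐ z ∂(volume.restrict (Iio (0 : ℝ) ×ˢ (univ : Set (EuclideanSpace ℝ (Fin 3))))),
      nsRescale (Real.exp σ) w z.1 z.2 = w z.1 z.2 := by
    intro σ hσ
    have hball : ∀ R : ℝ, 0 < R → ∀ᵐ z ∂(volume.restrict (parabolicCylinder R (0 : ℝ × EuclideanSpace ℝ (Fin 3)))),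
        nsRescale (Real.exp σ) w z.1 z.2 = w z.1 z.2 := by
      intro R hR
      have h0 := rlNearIdentityDSS_ball (lam := fun j => lam (ψ j)) (fun j => hlam1 (ψ j))
        (hlim.comp hψ.tendsto_atTop) (u := fun j => u (ψ j)) (fun j => hmeas (ψ j)) hmeasw hconv
        (fun j => hdss (ψ j)) horbit hσ hR
      have hwm1 : AEStronglyMeasurable (uncurry w)
          (volume.restrict (parabolicCylinder R (0 : ℝ × EuclideanSpace ℝ (Fin 3)))) := by
        have h := hmeasw 1 one_pos R hR
        rwa [nsRescale_one] at h
      rw [eLpNorm_eq_zero_iff ((hmeasw _ (Real.exp_pos σ) R hR).sub hwm1) (by norm_num)] at h0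
      filter_upwards [h0] with z hz
      rw [Pi.sub_apply, Pi.zero_apply, sub_eq_zero] at hz
      exact hz
    refine ae_restrict_of_ae_restrict_of_subset lowerHalf_subset_iUnion_parabolicCylinder ?_
    rw [ae_restrict_iUnion_iff]
    intro n
    exact hball _ (by positivity)
  have hss : ∀ σ : ℝ, ∀ᵐ z ∂(volume.restrict (Iio (0 : ℝ) ×ˢ (univ : Set (EuclideanSpace ℝ (Fin 3))))),
      nsRescale (Real.exp σ) w z.1 z.2 = w z.1 z.2 := by
    intro σ
    rcases lt_trichotomy σ 0 with hneg | hzero | hposσ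
    · have h := rlNearIdentityDSS_ae_inv (Real.exp_pos (-σ)) (hpos (-σ) (neg_pos.2 hneg))
      rwa [← Real.exp_neg, neg_neg] at h
    · subst hzero
      exact Eventually.of_forall fun z => by rw [Real.exp_zero, nsRescale_one]
    · exact hpos σ hposσ
  -- S3: continuous, pointwise scale-invariant Type-I ancient mild representative; S4: it vanishes
  obtain ⟨v, hv, hvss, hae⟩ := stub_rlSelfSimilarRepr C w q H hsw' hwg' hI' hdec' hss
  have hv0 : ∀ t : ℝ, t < 0 → ∀ x, v t x = 0 := stub_rlSelfSimilarMildVanishes C v hv hvss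
  -- hence `w = 0` a.e. on the slab and on `Q(0,1)`: not singular
  have hw0 : ∀ᵐ z ∂(volume.restrict (Iio (0 : ℝ) ×ˢ (univ : Set (EuclideanSpace ℝ (Fin 3))))),
      uncurry w z = (0 : ℝ × EuclideanSpace ℝ (Fin 3) → EuclideanSpace ℝ (Fin 3)) z := by
    filter_upwards [hae, ae_restrict_mem (measurableSet_Iio.prod MeasurableSet.univ)] with z hz hzm
    rw [hz, Pi.zero_apply]
    exact hv0 z.1 hzm.1 z.2
  have hQ : ∀ᵐ z ∂(volume.restrict (parabolicCylinder 1 (0 : ℝ × EuclideanSpace ℝ (Fin 3)))),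
      uncurry w z = (0 : ℝ × EuclideanSpace ℝ (Fin 3) → EuclideanSpace ℝ (Fin 3)) z :=
    ae_restrict_of_ae_restrict_of_subset (parabolicCylinder_origin_subset_slab 1) hw0
  have h0 : eLpNorm (uncurry w) ∞
      (volume.restrict (parabolicCylinder 1 (0 : ℝ × EuclideanSpace ℝ (Fin 3)))) = 0 := by
    rw [eLpNorm_congr_ae hQ, eLpNorm_zero]
  have htop := hsing' 1 one_pos
  rw [h0] at htop
  exact ENNReal.zero_ne_top htop

end Summit.NavierStokesRegularity.NavierStokesRegularity.Theorems

end
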